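import Mathlib.Analysis.Normed.Module.Connected
import Mathlib.Analysis.Complex.Basic
import Mathlib.LinearAlgebra.Matrix.Determinant.Basic
import Mathlib.RingTheory.Polynomial.Basic
import Mathlib.Topology.Instances.Matrix
import Mathlib.Algebra.Polynomial.Roots
import Mathlib.LinearAlgebra.Complex.FiniteDimensional
import HarnessLib

/-!
# `GLₙ(ℂ)` is path connected

The set `{M ∈ Mₙ(ℂ) | det M ∈ ℂˣ}` of invertible complex matrices is path connected
(`isPathConnected_isUnit_det`), by the classical one-line argument: on the complex line
`s ↦ (1 - s)·1 + s·A` through `1` and an invertible `A` the determinant is a non-zero polynomial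
in `s` (`linePoly`, `eval_det_linePoly`), hence vanishes only on a finite set, whose complement in
`ℂ ≅ ℝ²` is path connected (Mathlib's `Set.Countable.isPathConnected_compl_of_one_lt_rank`); a
path from `0` to `1` avoiding it gives a path of invertible matrices from `1` to `A`
(`joinedIn_isUnit_det_one`). Everything is proved; no named facts. (Used by topological
`K`-theory: `K̃(S¹) = 0`, clutching over spheres.)

## References

* A. Hatcher, *Vector Bundles and K-Theory* (v2.2, 2017), proof of Prop. 1.11/Example 1.12
  ("`GLₙ(ℂ)` is path-connected", by a polynomial-path argument). Standard; tagged folklore.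

## Design notes

* Stated for the set `{M | IsUnit M.det}` in `Matrix n n ℂ` (rather than the group
  `Matrix.GeneralLinearGroup`), which is the form used for matrix-valued clutching functions.
* Mathlib searches: no `isPathConnected`/`PathConnectedSpace` statement for `GL`, unitary or
  invertible matrices in Mathlib (`lean search`, 2026-08-15); the tree's
  `Literature.MathematicalPhysics.QuantumLattice.BargmannHallWightmanConnected` treats the
  complex Lorentz group by charts (different set, different method). Nothing restated.
-/

noncomputable section

open Polynomial Set Matrix

namespace Literature.LinearAlgebra.Matrix

variable {n : Type*} [Fintype n] [DecidableEq n]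

/-- The affine complex line of matrices `s ↦ (1 - s) • 1 + s • A` through `1` and `A`. [folklore] -/
def linePoly (A : Matrix n n ℂ) : Matrix n n ℂ[X] := (1 - (X : ℂ[X])) • (1 : Matrix n n ℂ[X]) + (X : ℂ[X]) • A.map C

/-- Evaluating the line of matrices at `s`. [folklore] -/
theorem eval_linePoly (A : Matrix n n ℂ) (s : ℂ) :
    (evalRingHom s).mapMatrix (linePoly A) = (1 - s) • (1 : Matrix n n ℂ) + s • A := by
  ext i j
  simp [linePoly, Matrix.map_apply, Matrix.smul_apply, Matrix.one_apply, Matrix.add_apply]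
  split_ifs <;> simp [mul_comm]

/-- `det ((1 - s) 1 + s A)` is a polynomial in `s`, with value `1` at `s = 0`. [folklore] -/
theorem eval_det_linePoly (A : Matrix n n ℂ) (s : ℂ) :
    (linePoly A).det.eval s = ((1 - s) • (1 : Matrix n n ℂ) + s • A).det := by
  rw [← coe_evalRingHom, RingHom.map_det, eval_linePoly]

/-- The determinant along the line is a non-zero polynomial. [folklore] -/
theorem det_linePoly_ne_zero (A : Matrix n n ℂ) : (linePoly A).det ≠ 0 := by
  intro h
  have := eval_det_linePoly A 0
  rw [h, eval_zero] at this
  simp at this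

/-- **`GLₙ(ℂ)` is path connected**: every invertible complex matrix is joined to `1` inside the
invertible matrices. Proof: on the complex line `s ↦ (1 - s) 1 + s A` the determinant is a
non-zero polynomial in `s`, so it vanishes at finitely many `s`; the complement of a finite set
in `ℂ ≅ ℝ²` is path connected, so `0` and `1` are joined by a path `γ` avoiding it, and
`s ↦ (1 - γ s) 1 + γ s A` is the required path. [folklore] -/
theorem joinedIn_isUnit_det_one (A : Matrix n n ℂ) (hA : IsUnit A.det) :
    JoinedIn {M : Matrix n n ℂ | IsUnit M.det} 1 A := by
  set Z : Set ℂ := {s | ((linePoly A).det).IsRoot s}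
  have hZ : Z.Finite := Polynomial.finite_setOf_isRoot (det_linePoly_ne_zero A)
  have hconn : IsPathConnected Zᶜ := by
    refine hZ.countable.isPathConnected_compl_of_one_lt_rank ?_
    rw [← Module.finrank_eq_rank, Complex.finrank_real_complex]; norm_num
  have h0 : (0 : ℂ) ∈ Zᶜ := by
    simp only [Z, mem_compl_iff, mem_setOf_eq, IsRoot.def, eval_det_linePoly]; simp
  have h1 : (1 : ℂ) ∈ Zᶜ := by
    simp only [Z, mem_compl_iff, mem_setOf_eq, IsRoot.def, eval_det_linePoly]
    simpa using hA.ne_zero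
  obtain ⟨γ, hγ⟩ := hconn.joinedIn 0 h0 1 h1
  let F : C(ℂ, Matrix n n ℂ) := ⟨fun s ↦ (1 - s) • (1 : Matrix n n ℂ) + s • A, by fun_prop⟩
  refine ⟨⟨⟨fun t ↦ F (γ t), F.continuous.comp γ.continuous⟩, by simp [F], by simp [F]⟩, fun t ↦ ?_⟩
  have ht := hγ t
  simp only [Z, mem_compl_iff, mem_setOf_eq, IsRoot.def, eval_det_linePoly] at ht
  exact isUnit_iff_ne_zero.2 ht

/-- **The invertible complex matrices form a path-connected set.** [folklore] -/
theorem isPathConnected_isUnit_det : IsPathConnected {M : Matrix n n ℂ | IsUnit M.det} :=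
  ⟨1, by simp, fun A hA ↦ joinedIn_isUnit_det_one A hA⟩

/-- Any two invertible complex matrices are joined by a path of invertible matrices. [folklore] -/
theorem joinedIn_isUnit_det {A B : Matrix n n ℂ} (hA : IsUnit A.det) (hB : IsUnit B.det) :
    JoinedIn {M : Matrix n n ℂ | IsUnit M.det} A B :=
  isPathConnected_isUnit_det.joinedIn A hA B hB

end Literature.LinearAlgebra.Matrix

end
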